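import Literature.AlgebraicGeometry.ModuliOfAbelianVarieties.SiegelFamilyQCMLoci
import HarnessLib

/-!
# Simple and non-simple pieces of the intersection of two Humbert surfaces; Hashimoto–Murabayashi's two Shimura curves
# as QCM-loci `𝓠((5 1; 1 5))`, `𝓠((5 0; 0 8))`; when `H_Δ(𝔥₂) = N_Δ` (Runge 1999 §6 pp. 294–296, Example 17; Hashimoto–Murabayashi 1995 §4)

Layer `Literature/AlgebraicGeometry/ModuliOfAbelianVarieties`, namespace
`Literature.AlgebraicGeometry.ModuliOfAbelianVarieties.SiegelModuli`; lane `lit-hodgefound` (Track 2 foundations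
library, Layer A4), seat `lit-hodgefound-skel-4`, row **A4-69**, FILE 2 (rider on FILE 1 `SiegelFamilyQCMLoci`: the loci
`𝓗(S) = humbertPairLocus S`, `𝓠(S) = qcmLocus S`, Cor. 15's decomposition and Examples 16–17).

## Sources, verbatim

* B. Runge, Tohoku Math. J. 51 (1999), §6 p. 296 (held `paper:doi-10-2748-tmj-1178224764`, p0014): "if the discriminant
  form of an QCM-order `R` represents a non-zero square, all period points correspond to non-simple abelian surfaces.
  We call the corresponding QCM-curves non-simple. Otherwise we call it simple. A CM-point is simple if it corresponds
  to a simple abelian surface. There cannot be any simple CM-point on a QCM-curve. […] However, up to countable many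
  exceptions any period point on a simple QCM-curve corresponds to a simple abelian surface"; Example 17, p. 300
  (p0018): "`C_{(5 1; 1 5)}` (simple, which is a component of `H₅ ∩ H₈`) … `C_{(5 0; 0 8)}` (simple, which is another
  component of `H₅ ∩ H₈`)".
* K. Hashimoto, N. Murabayashi, Tohoku Math. J. 47 (1995) (held RIMS Kôkyûroku 843 version,
  `paper:doi-10-2748-tmj-1178225596`), §4.2 p. 196 (p0014): "`B₁₀ = ℚ + ℚi + ℚj + ℚij`, `i² = −10`, `j² = 13`, `ji = −ij`
  […] Lemma 4.2.1 `Ω(z)` has two singular relations: `−5τ₁ + 55τ₂ + 15τ₃ + (τ₂² − τ₁τ₃) + 830 = 0` […]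
  `−4τ₁ + 56τ₂ + 12τ₃ + (τ₂² − τ₁τ₃) + 830 = 0` […] with `Δ = 8`, `Δ = 5`". OCR caveat (numbers, not adjectives): the
  scan's layout attaches the two labels `Δ = 8` / `Δ = 5` in the order OPPOSITE to the one forced by the printed
  coefficients under Def. 3.6's `Δ = b² − 4ac − 4de` (`(−5, 55, 15, 1, 830) ↦ 3025 + 300 − 3320 = 5`,
  `(−4, 56, 12, 1, 830) ↦ 3136 + 192 − 3320 = 8`); this file records the coefficients as printed and the invariants as
  computed — the PAIR `{5, 8}` and the discriminant matrix `(5 0; 0 8)` (polar form `0`, `det = 40 = 4·10 = 4·disc B₁₀`)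
  do not depend on the labelling.

## What is proved (definitions with bodies `hmRelTen`, `hmRelTen′`, `hmSp`, `hmSpTen`; theorems; NO named fact, NO sorry,
## net debt 0)

* §1 **`isSimple_iff_of_mem_humbertPairLocus`** (on `𝓗(S)`, `det S ≠ 0`: `X_Z` simple ⟺ `ρ(X_Z) = 3 ∧ IsSimpleDisc S` —
  Runge's simple / non-simple QCM-curves pointwise, rows A4-66 F5 / A4-68 F1–F2), `not_isSimple_of_mem_humbertPairLocus`
  (non-simple class ⟹ every surface non-simple), `isSimple_iff_finrank_eq_three_of_isSimpleDisc` (simple class ⟹ the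
  non-simple points are exactly the `ρ = 4` CM points), `finrank_neronSeveriGroup_eq_three_or_four_of_mem_humbertPairLocus`,
  `isSimpleDisc_example_sixteen` (the simple pieces of `H₅ ∩ H₈` are `𝓗((5 0; 0 8))`, `𝓗((5 1; 1 5))`).
* §2 defs `hmRelTen = (−5, 55, 15, 1, 830)`, `hmRelTen′ = (−4, 56, 12, 1, 830)`; `humbertInvariant_hmRelTen` (`5`, `8`),
  **`discMatrix_hmRelTen = (5 0; 0 8)`** (Runge's reduced simple class of `d = 10`), `pairDiscr_hmRelTen = 10`,
  `isPrimitiveRel_hmRelTen`, **`inter_humbertLocus_hmRelTen_subset`** (the discriminant-`10` family lies on the piece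
  `𝓗((5 0; 0 8)) ⊆ H₅(𝔥₂) ∩ H₈(𝔥₂)` — with FILE 1's `inter_humbertLocus_hmRel_subset` BOTH of Hashimoto–Murabayashi's
  Shimura curves sit on the two simple pieces of Runge's Example 17), `isSimple_iff_of_mem_hmRelTen` (simple ⟺ `ρ = 3`,
  then `End_ℚ(X_Z) = ℚ(α, β) ≃ ℍ[ℚ, 5, −40]`).
* §3 defs `hmSp`, `hmSpTen` (explicit matrices of `Sp₄(ℤ)`, `decide`): `hmSp_symplectic`, `humbertVectorConj_hmSp` (`hmRel ↦`
  Humbert's normal form `(2, 0, −1, 0, 0)`, `hmRel′ ↦ (−2, 1, 0, −1, 1)`), **`humbertPairAlgInt_hmRel_eq`** (the discriminant-`6`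
  pair of row A4-68 FILE 2 generates a QCM-ORDER: `ℚ(α, β) ∩ M₄(ℤ) = ℤ[α, β]`, by Runge's criterion row A4-67 FILE 3
  `humbertPairAlgInt_eq_of_conj_normalForm`), **`inter_humbertLocus_hmRel_subset_qcmLocus`** (`⊆ 𝓠((5 1; 1 5))`, upgrading
  FILE 1's `⊆ 𝓗`), `endRingInt_eq_of_mem_hmRel` (at `ρ = 3` points `ρ_r(End X_Z) = ℤ[α, β]`, `d = 6`); likewise
  `hmSpTen_symplectic`, `humbertVectorConj_hmSpTen` (`↦ (1, 1, −1, 0, 0)`, `(1, 2, 2, −1, 3)`), **`humbertPairAlgInt_hmRelTen_eq`**,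
  **`inter_humbertLocus_hmRelTen_subset_qcmLocus`** (`⊆ 𝓠((5 0; 0 8))`), `endRingInt_eq_of_mem_hmRelTen` (`d = 10`).
* §4 **`humbertLocusOfInvariant_eq_humbertLocusPrim_of_forall`** (`H_Δ(𝔥₂) = N_Δ` when no `m ≥ 2`, `m² ∣ Δ`, has `Δ/m²`
  a positive discriminant), `humbertLocusOfInvariant_twelve_eq_humbertLocusPrim`.

## Scope

Pointwise statements only (no "almost all points", no components). The normalising matrices `hmSp`, `hmSpTen` are NOT
transcriptions of Hashimoto–Murabayashi's `M₁, M₂, N₁, N₂` (OCR-garbled in the held scan): they were found by a search in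
the generators of row A4-65 FILE 1 and are certified by `decide`; any `M ∈ Sp₄(ℤ)` with the two displayed properties
serves Runge's criterion. That the two families have `ρ = 3` points (so that `End = ℤ[α, β]` somewhere) is not shown.
-/

noncomputable section

open Matrix Module
open scoped Quaternion

namespace Literature.AlgebraicGeometry.ModuliOfAbelianVarieties

namespace SiegelModuli

open Literature.NumberTheory.Automorphic (siegelUpperHalfSpace)
open Literature.NumberTheory.ModularForms.SiegelUpperHalfSpace
open Literature.Geometry.Kaehler Literature.Geometry.Kaehler.ComplexTorus

/-! ## §1 Simple and non-simple pieces: on `𝓗(S)`, `X_Z` is simple iff `ρ(X_Z) = 3` and the CLASS of `S` is simple -/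

section SimplePieces

variable {S : Matrix (Fin 2) (Fin 2) ℤ} {Z : siegelUpperHalfSpace 2}

/-- **RUNGE'S SIMPLE / NON-SIMPLE QCM-CURVES, POINTWISE ON A PIECE `𝓗(S)`** (`det S ≠ 0`): `X_Z` is simple iff
`ρ(X_Z) = 3` and the class of `S` is simple (represents no non-zero square) — "if the discriminant form of an
QCM-order `R` represents a non-zero square, all period points correspond to non-simple abelian surfaces. We call the
corresponding QCM-curves non-simple. Otherwise we call it simple. … There cannot be any simple CM-point on a QCM-curve"
(the `ρ = 4` points are the CM points, never simple: row A4-66 FILES 4–5 `isSimple_iff_of_mem_inter`, in row A4-68 FILE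
1's class vocabulary `IsSimpleDisc`, a `Gl(2, ℤ)`-class invariant). [cite: Runge1999EndomorphismRingsAbelianSurfaces, §6 p. 296] -/
theorem isSimple_iff_of_mem_humbertPairLocus (hdet : S.det ≠ 0) (hZ : Z ∈ humbertPairLocus S) :
    IsSimple (prinPeriod Z : (Fin 2 ⊕ Fin 2 → ℝ) ≃L[ℝ] (Fin 2 → ℂ)) ↔
      finrank ℤ (neronSeveriGroup (prinPeriod Z : (Fin 2 ⊕ Fin 2 → ℝ) ≃L[ℝ] (Fin 2 → ℂ))) = 3 ∧ IsSimpleDisc S := by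
  obtain ⟨q, q', hqS, h₀, h₁, hli⟩ := exists_pair_of_mem_humbertPairLocus hdet hZ
  rw [isSimple_iff_of_mem_inter h₀ h₁ hli, ← isSimpleDisc_discMatrix_iff, hqS]

/-- **On a NON-SIMPLE piece every surface is non-simple** (any `ρ`). [cite: Runge1999EndomorphismRingsAbelianSurfaces, §6 p. 296 ("all period points correspond to non-simple abelian surfaces")] -/
theorem not_isSimple_of_mem_humbertPairLocus (hS : ¬ IsSimpleDisc S) (hZ : Z ∈ humbertPairLocus S) :
    ¬ IsSimple (prinPeriod Z : (Fin 2 ⊕ Fin 2 → ℝ) ≃L[ℝ] (Fin 2 → ℂ)) := by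
  obtain ⟨q, q', hqS, h₀, h₁⟩ := hZ
  exact not_isSimple_of_not_isSimpleDisc h₀ h₁ (hqS ▸ hS)

/-- **On a SIMPLE piece the non-simple surfaces are exactly the `ρ = 4` (CM) points**: `X_Z` simple ⟺ `ρ(X_Z) = 3`.
[cite: Runge1999EndomorphismRingsAbelianSurfaces, §6 p. 296 ("up to countable many exceptions any period point on a simple QCM-curve corresponds to a simple abelian surface … There cannot be any simple CM-point on a QCM-curve")] -/
theorem isSimple_iff_finrank_eq_three_of_isSimpleDisc (hdet : S.det ≠ 0) (hS : IsSimpleDisc S)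
    (hZ : Z ∈ humbertPairLocus S) :
    IsSimple (prinPeriod Z : (Fin 2 ⊕ Fin 2 → ℝ) ≃L[ℝ] (Fin 2 → ℂ)) ↔
      finrank ℤ (neronSeveriGroup (prinPeriod Z : (Fin 2 ⊕ Fin 2 → ℝ) ≃L[ℝ] (Fin 2 → ℂ))) = 3 := by
  rw [isSimple_iff_of_mem_humbertPairLocus hdet hZ]
  exact ⟨fun h ↦ h.1, fun h ↦ ⟨h, hS⟩⟩

/-- `ρ(X_Z) ∈ {3, 4}` on every piece with `det S ≠ 0` (row A4-66 FILE 3's table line). [cite: BirkenhakeWilhelm2003, §4 Prop. 4.9 (3) (p. 1831)] -/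
theorem finrank_neronSeveriGroup_eq_three_or_four_of_mem_humbertPairLocus (hdet : S.det ≠ 0) (hZ : Z ∈ humbertPairLocus S) :
    finrank ℤ (neronSeveriGroup (prinPeriod Z : (Fin 2 ⊕ Fin 2 → ℝ) ≃L[ℝ] (Fin 2 → ℂ))) = 3 ∨
      finrank ℤ (neronSeveriGroup (prinPeriod Z : (Fin 2 ⊕ Fin 2 → ℝ) ≃L[ℝ] (Fin 2 → ℂ))) = 4 := by
  obtain ⟨q, q', -, h₀, h₁, hli⟩ := exists_pair_of_mem_humbertPairLocus hdet hZ
  rcases finrank_neronSeveriGroup_and_finrank_endAlgRat_of_mem_inter h₀ h₁ hli with ⟨h, -⟩ | ⟨h, -⟩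
  · exact Or.inl h
  · exact Or.inr h

/-- **The simple pieces of `H₅ ∩ H₈` are exactly `𝓗((5 0; 0 8))` and `𝓗((5 1; 1 5))`**: the classes `(5 0; 0 8)` (`d = 10`)
and `(5 1; 1 5)` (`d = 6`) are simple, `(5 2; 2 8)` represents `9` and `(1 0; 0 4)` represents `1` (Example 17's labels
"simple" / "non-simple"; row A4-68 FILE 1). [cite: Runge1999EndomorphismRingsAbelianSurfaces, §6 Example 17 (p. 300) and Remark 14 (p. 299)] -/
theorem isSimpleDisc_example_sixteen :
    IsSimpleDisc !![5, 0; 0, 8] ∧ IsSimpleDisc !![5, 1; 1, 5] ∧ ¬ IsSimpleDisc !![5, 2; 2, 8] ∧ ¬ IsSimpleDisc !![1, 0; 0, 4] :=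
  ⟨isSimpleDisc_five_zero_eight, isSimpleDisc_five_one_five,
    not_isSimpleDisc_of_eq_sq (x := 1) (y := -1) (m := 3) (by norm_num) (by simp [discBinForm]),
    not_isSimpleDisc_of_eq_sq (x := 1) (y := 0) (m := 1) (by norm_num) (by simp [discBinForm])⟩

end SimplePieces

/-! ## §2 Hashimoto–Murabayashi's discriminant-`10` family lies on Runge's simple piece `𝓗((5 0; 0 8))` of `H₅ ∩ H₈` -/

section HashimotoMurabayashiTen

/-- **Hashimoto–Murabayashi's first singular relation of the discriminant-`10` modular embedding (Lemma 4.2.1):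
`−5τ₁ + 55τ₂ + 15τ₃ + (τ₂² − τ₁τ₃) + 830 = 0`**, as the B–W vector `(−5, 55, 15, 1, 830)`. OCR caveat (numbers): the
held scan attaches the labels "`Δ = 8`" / "`Δ = 5`" to the two printed relations in the order opposite to the one
FORCED by the printed coefficients under `Δ = b² − 4ac − 4de` (`3025 + 300 − 3320 = 5` here, `3136 + 192 − 3320 = 8`
for the second); the coefficients are recorded as printed and the invariants as computed (`humbertInvariant_hmRelTen`).
[cite: HashimotoMurabayashi1995, §4.2 Lemma 4.2.1 (RIMS Kôkyûroku 843 version of the held text, p. 196)] -/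
def hmRelTen : Fin 5 → ℤ := ![-5, 55, 15, 1, 830]

/-- **Hashimoto–Murabayashi's second singular relation of the discriminant-`10` embedding:
`−4τ₁ + 56τ₂ + 12τ₃ + (τ₂² − τ₁τ₃) + 830 = 0`**, as `(−4, 56, 12, 1, 830)`. [cite: HashimotoMurabayashi1995, §4.2 Lemma 4.2.1 (p. 196)] -/
def hmRelTen' : Fin 5 → ℤ := ![-4, 56, 12, 1, 830]

/-- The invariants of the two relations are `5` and `8` (`= b² − 4ac − 4de`). [cite: HashimotoMurabayashi1995, §4.2 Lemma 4.2.1 (p. 196: "`Δ = 8`", "`Δ = 5`")] -/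
theorem humbertInvariant_hmRelTen : humbertInvariant hmRelTen = 5 ∧ humbertInvariant hmRelTen' = 8 := by
  constructor <;> simp [humbertInvariant, hmRelTen, hmRelTen']

/-- **`S_Δ = (5 0; 0 8)` for the discriminant-`10` pair** — Runge's REDUCED simple class of `d = 10` on the nose ("`C_{(5 0; 0 8)}`
(simple, which is another component of `H₅ ∩ H₈`)"), matching `disc B₁₀ = 10`. [cite: Runge1999EndomorphismRingsAbelianSurfaces, §6 Example 17 (p. 300)] [cite: HashimotoMurabayashi1995, §4.2 (p. 196: "`B₁₀ … i² = −10, j² = 13`")] -/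
theorem discMatrix_hmRelTen : discMatrix hmRelTen hmRelTen' = !![5, 0; 0, 8] := by
  ext i j
  fin_cases i <;> fin_cases j <;> simp [discMatrix, humbertInvariant, humbertPolar, hmRelTen, hmRelTen']

/-- `d(ℤ[α, β]) = 10` for the discriminant-`10` pair (`= det S_Δ/4`). [cite: Runge1999EndomorphismRingsAbelianSurfaces, §6 Thm. 7 (p. 295)] -/
theorem pairDiscr_hmRelTen : pairDiscr hmRelTen hmRelTen' = 10 :=
  pairDiscr_eq_of_discMatrix_eq discMatrix_hmRelTen (by rw [Matrix.det_fin_two_of]; norm_num)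

/-- Both relations are primitive vectors and the pair is independent. [cite: HashimotoMurabayashi1995, Def. 3.6 and Lemma 4.2.1] -/
theorem isPrimitiveRel_hmRelTen :
    IsPrimitiveRel hmRelTen ∧ IsPrimitiveRel hmRelTen' ∧
      LinearIndependent ℚ ![(fun i ↦ (hmRelTen i : ℚ)), (fun i ↦ (hmRelTen' i : ℚ))] := by
  have prim : ∀ q : Fin 5 → ℤ, q 3 = 1 → IsPrimitiveRel q := fun q hq m p h ↦ by
    have h3 : (m • p) 3 = 1 := by rw [← h]; exact hq
    rw [Pi.smul_apply, smul_eq_mul] at h3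
    exact Int.isUnit_iff.1 (isUnit_of_dvd_one ⟨p 3, h3.symm⟩)
  exact ⟨prim _ rfl, prim _ rfl, linearIndependent_of_det_discMatrix_ne_zero (by rw [discMatrix_hmRelTen, Matrix.det_fin_two_of]; norm_num)⟩

/-- **The discriminant-`10` family lies on Runge's simple `d = 10` piece of `H₅ ∩ H₈`**:
`H_{hmRelTen} ∩ H_{hmRelTen′} ⊆ 𝓗((5 0; 0 8)) ⊆ H₅(𝔥₂) ∩ H₈(𝔥₂)`. [cite: Runge1999EndomorphismRingsAbelianSurfaces, §6 Example 17 (p. 300)] [cite: HashimotoMurabayashi1995, §1 p. 185 and §4.2] -/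
theorem inter_humbertLocus_hmRelTen_subset :
    humbertLocus (fun i ↦ (hmRelTen i : ℂ)) ∩ humbertLocus (fun i ↦ (hmRelTen' i : ℂ)) ⊆ humbertPairLocus !![5, 0; 0, 8] ∧
      humbertPairLocus !![5, 0; 0, 8] ⊆ humbertLocusOfInvariant 5 ∩ humbertLocusOfInvariant 8 :=
  ⟨discMatrix_hmRelTen ▸ inter_humbertLocus_subset_humbertPairLocus hmRelTen hmRelTen',
    humbertPairLocus_offDiag_subset_inter (by norm_num)⟩

/-- **On the discriminant-`10` family `X_Z` is simple iff `ρ(X_Z) = 3`**, and then `End_ℚ(X_Z) = ℚ(α, β) ≃ ℍ[ℚ, 5, −40]`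
is the quaternion DIVISION algebra of discriminant `10` (row A4-66 FILE 3). [cite: HashimotoMurabayashi1995, §1 (case (ii), Shimura curves) and §4.2] [cite: Runge1999EndomorphismRingsAbelianSurfaces, §6 Example 17 (p. 300: "`C_{(5 0; 0 8)}` (simple …)")] -/
theorem isSimple_iff_of_mem_hmRelTen {Z : siegelUpperHalfSpace 2} (h₀ : Z ∈ humbertLocus (fun i ↦ (hmRelTen i : ℂ)))
    (h₁ : Z ∈ humbertLocus (fun i ↦ (hmRelTen' i : ℂ))) :
    (IsSimple (prinPeriod Z : (Fin 2 ⊕ Fin 2 → ℝ) ≃L[ℝ] (Fin 2 → ℂ)) ↔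
        finrank ℤ (neronSeveriGroup (prinPeriod Z : (Fin 2 ⊕ Fin 2 → ℝ) ≃L[ℝ] (Fin 2 → ℂ))) = 3) ∧
      (IsSimple (prinPeriod Z : (Fin 2 ⊕ Fin 2 → ℝ) ≃L[ℝ] (Fin 2 → ℂ)) →
        endAlgRat (prinPeriod Z : (Fin 2 ⊕ Fin 2 → ℝ) ≃L[ℝ] (Fin 2 → ℂ)) = humbertPairAlg hmRelTen hmRelTen' ∧
          Nonempty (ℍ[ℚ, (5 : ℚ), (-40 : ℚ)] ≃ₐ[ℚ] humbertPairAlg hmRelTen hmRelTen')) := by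
  obtain ⟨-, -, hli⟩ := isPrimitiveRel_hmRelTen
  refine ⟨isSimple_iff_finrank_eq_three_of_isSimpleDisc (S := !![5, 0; 0, 8]) (by rw [Matrix.det_fin_two_of]; norm_num)
    isSimpleDisc_five_zero_eight ⟨_, _, discMatrix_hmRelTen, h₀, h₁⟩, fun hX ↦ ⟨endAlgRat_eq_humbertPairAlg_of_isSimple hX h₀ h₁ hli, ?_⟩⟩
  have hp : humbertPolar hmRelTen hmRelTen' = 0 := by
    have := congrFun (congrFun discMatrix_hmRelTen 0) 1
    simpa [discMatrix] using this
  have e := humbertPairAlgEquiv hmRelTen hmRelTen' (by rw [humbertInvariant_hmRelTen.1]; norm_num)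
    (by rw [humbertInvariant_hmRelTen.1, humbertInvariant_hmRelTen.2, hp]; norm_num)
  have h5 : ((humbertInvariant hmRelTen : ℤ) : ℚ) = 5 := by rw [humbertInvariant_hmRelTen.1]; norm_num
  have h40 : ((humbertPolar hmRelTen hmRelTen' ^ 2 - humbertInvariant hmRelTen * humbertInvariant hmRelTen' : ℤ) : ℚ) = -40 := by
    rw [hp, humbertInvariant_hmRelTen.1, humbertInvariant_hmRelTen.2]; norm_num
  rw [h5, h40] at e
  exact ⟨e⟩

end HashimotoMurabayashiTen

/-! ## §3 Both Hashimoto–Murabayashi pairs generate QCM-ORDERS: their Shimura curves lie on the QCM-loci `𝓠((5 1; 1 5))`, `𝓠((5 0; 0 8))` -/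

section SaturationHM

/-- A symplectic matrix normalising the discriminant-`6` pair: `q^M = (2, 0, −1, 0, 0)` (Humbert's normal form of
invariant `8`) and `q′^M = (−2, 1, 0, −1, 1)` (coprime `(d′, e′) = (−1, 1)`). Found by search in the generators of row
A4-65 FILE 1; it plays the role of Hashimoto–Murabayashi's `M₁, M₂` of Lemma 4.1.4 (OCR-garbled in the held scan, not
transcribed) in Runge's saturation criterion (row A4-67 FILE 3 `humbertPairAlgInt_eq_of_conj_normalForm`).
[cite: HashimotoMurabayashi1995, §4.1 Lemma 4.1.4 (p. 194)] [cite: Runge1999EndomorphismRingsAbelianSurfaces, §6 proof of Thm. 7 (p. 295: "`g.c.d.(b, c) = 1` … implies that `ℚ(α, β) ∩ M₄(ℤ) = ℤ ⊕ ℤα ⊕ ℤβ ⊕ ℤαβ`")] -/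
def hmSp : Matrix (Fin 2 ⊕ Fin 2) (Fin 2 ⊕ Fin 2) ℤ :=
  Matrix.fromBlocks !![0, 0; 0, 0] !![-1, 0; 0, 1] !![1, 0; 0, -1] !![1, 0; 0, 0]

/-- `hmSp ∈ Sp₄(ℤ)` (by `decide`). [cite: HashimotoMurabayashi1995, §4.1 Lemma 4.1.4 (p. 194)] -/
theorem hmSp_symplectic : hmSpᵀ * typeForm (fun _ : Fin 2 ↦ 1) * hmSp = typeForm fun _ : Fin 2 ↦ 1 := by
  decide

/-- `hmSp` takes `hmRel` to the normal form `(2, 0, −1, 0, 0)` ("`−2τ₁′ + τ₃′ = 0 (Δ = 8)`" up to the sign convention of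
row A4-64) and `hmRel′` to `(−2, 1, 0, −1, 1)` (by `decide`). [cite: HashimotoMurabayashi1995, §4.1 Lemma 4.1.4 (p. 194)] -/
theorem humbertVectorConj_hmSp :
    humbertVectorConj hmSp hmRel = humbertNormalForm 2 0 ∧ humbertVectorConj hmSp hmRel' = ![-2, 1, 0, -1, 1] := by
  constructor <;> decide

/-- **The discriminant-`6` pair generates a QCM-ORDER: `ℚ(α, β) ∩ M₄(ℤ) = ℤ[α, β]`** (Runge's criterion after the
normalisation `hmSp`; `d(ℤ[α, β]) = 6 = disc B₆` is the discriminant of a MAXIMAL order — that `ℤ[α, β]` is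
Hashimoto–Murabayashi's `𝒪₆` up to the embedding is not formalised). [cite: Runge1999EndomorphismRingsAbelianSurfaces, §6 proof of Thm. 7 (p. 295) and p. 294 ("`R = L ∩ M₄(ℤ)`")] [cite: HashimotoMurabayashi1995, §4.1 (p. 192: "`𝒪₆` … a maximal order")] -/
theorem humbertPairAlgInt_hmRel_eq : humbertPairAlgInt hmRel hmRel' = (humbertPairOrder hmRel hmRel').toSubring :=
  humbertPairAlgInt_eq_of_conj_normalForm hmSp_symplectic humbertVectorConj_hmSp.1
    (by rw [humbertVectorConj_hmSp.2]; exact isCoprime_one_right.neg_left)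

/-- **Hashimoto–Murabayashi's discriminant-`6` Shimura curve lies on the QCM-locus `𝓠((5 1; 1 5))`** (FILE 1 had
`⊆ 𝓗((5 1; 1 5))`; saturation upgrades it). [cite: Runge1999EndomorphismRingsAbelianSurfaces, §6 Example 17 (p. 300: "`C_{(5 1; 1 5)}` (simple, which is a component of `H₅ ∩ H₈`)")] [cite: HashimotoMurabayashi1995, §4.1 Lemma 4.1.1 (p. 193)] -/
theorem inter_humbertLocus_hmRel_subset_qcmLocus :
    humbertLocus (fun i ↦ (hmRel i : ℂ)) ∩ humbertLocus (fun i ↦ (hmRel' i : ℂ)) ⊆ qcmLocus !![5, 1; 1, 5] := by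
  rw [← isGLEquiv_hmRel.qcmLocus_eq]
  rintro Z ⟨h₀, h₁⟩
  exact ⟨hmRel, hmRel', rfl, humbertPairAlgInt_hmRel_eq, h₀, h₁⟩

/-- **At the `ρ = 3` points of the discriminant-`6` family, `ρ_r(End X_Z) = ℤ[α, β]` IS the QCM-order** (Runge's
"`End(A_τ) = R`"; rows A4-66 FILE 5 + A4-67 FILE 2 + saturation). [cite: Runge1999EndomorphismRingsAbelianSurfaces, §6 Thm. 7 and proof of Cor. 9 (pp. 295–296)] -/
theorem endRingInt_eq_of_mem_hmRel {Z : siegelUpperHalfSpace 2} (h₀ : Z ∈ humbertLocus (fun i ↦ (hmRel i : ℂ)))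
    (h₁ : Z ∈ humbertLocus (fun i ↦ (hmRel' i : ℂ)))
    (h3 : finrank ℤ (neronSeveriGroup (prinPeriod Z : (Fin 2 ⊕ Fin 2 → ℝ) ≃L[ℝ] (Fin 2 → ℂ))) = 3) :
    endRingInt (prinPeriod Z : (Fin 2 ⊕ Fin 2 → ℝ) ≃L[ℝ] (Fin 2 → ℂ)) = (humbertPairOrder hmRel hmRel').toSubring :=
  (endRingInt_eq_humbertPairAlgInt_of_endAlgRat_eq
    (endAlgRat_eq_humbertPairAlg_of_finrank_eq_three h₀ h₁ linearIndependent_hmRel h3)).trans humbertPairAlgInt_hmRel_eq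

/-- A symplectic matrix normalising the discriminant-`10` pair: `q^M = (1, 1, −1, 0, 0)` (normal form of invariant `5`)
and `q′^M = (1, 2, 2, −1, 3)` (coprime `(d′, e′) = (−1, 3)`); it is a translation `shearLower` composed with
`partialJ₂` (found by search; plays the role of Hashimoto–Murabayashi's `N₁, N₂` of Lemma 4.2.2, OCR-garbled).
[cite: HashimotoMurabayashi1995, §4.2 Lemma 4.2.2 (p. 196)] [cite: Runge1999EndomorphismRingsAbelianSurfaces, §6 proof of Thm. 7 (p. 295)] -/
def hmSpTen : Matrix (Fin 2 ⊕ Fin 2) (Fin 2 ⊕ Fin 2) ℤ :=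
  Matrix.fromBlocks !![1, 0; 0, 0] !![0, 0; 0, -1] !![-15, 0; 27, 1] !![1, -27; 0, -5]

/-- `hmSpTen ∈ Sp₄(ℤ)` (by `decide`). [cite: HashimotoMurabayashi1995, §4.2 Lemma 4.2.2 (p. 196)] -/
theorem hmSpTen_symplectic : hmSpTenᵀ * typeForm (fun _ : Fin 2 ↦ 1) * hmSpTen = typeForm fun _ : Fin 2 ↦ 1 := by
  decide

/-- `hmSpTen` normalises the discriminant-`10` pair: `(1, 1, −1, 0, 0)` ("`−τ₁″ + τ₂″ + τ₃″ = 0 (Δ = 5)`" up to sign) and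
`(1, 2, 2, −1, 3)` (by `decide`). [cite: HashimotoMurabayashi1995, §4.2 Lemma 4.2.2 (p. 196)] -/
theorem humbertVectorConj_hmSpTen :
    humbertVectorConj hmSpTen hmRelTen = humbertNormalForm 1 1 ∧
      humbertVectorConj hmSpTen hmRelTen' = ![1, 2, 2, -1, 3] := by
  constructor <;> decide

/-- **The discriminant-`10` pair generates a QCM-ORDER: `ℚ(α, β) ∩ M₄(ℤ) = ℤ[α, β]`** (`d = 10 = disc B₁₀`, the discriminant
of a maximal order; the identification with `𝒪₁₀` is not formalised). [cite: Runge1999EndomorphismRingsAbelianSurfaces, §6 proof of Thm. 7 (p. 295) and p. 294] [cite: HashimotoMurabayashi1995, §4.2 (p. 196: "`𝒪₁₀`")] -/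
theorem humbertPairAlgInt_hmRelTen_eq :
    humbertPairAlgInt hmRelTen hmRelTen' = (humbertPairOrder hmRelTen hmRelTen').toSubring :=
  humbertPairAlgInt_eq_of_conj_normalForm hmSpTen_symplectic humbertVectorConj_hmSpTen.1
    (by rw [humbertVectorConj_hmSpTen.2]; decide)

/-- **Hashimoto–Murabayashi's discriminant-`10` Shimura curve lies on the QCM-locus `𝓠((5 0; 0 8))`.**
[cite: Runge1999EndomorphismRingsAbelianSurfaces, §6 Example 17 (p. 300: "`C_{(5 0; 0 8)}` (simple, which is another component of `H₅ ∩ H₈`)")] [cite: HashimotoMurabayashi1995, §4.2 Lemma 4.2.1 (p. 196)] -/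
theorem inter_humbertLocus_hmRelTen_subset_qcmLocus :
    humbertLocus (fun i ↦ (hmRelTen i : ℂ)) ∩ humbertLocus (fun i ↦ (hmRelTen' i : ℂ)) ⊆ qcmLocus !![5, 0; 0, 8] := by
  rintro Z ⟨h₀, h₁⟩
  exact ⟨hmRelTen, hmRelTen', discMatrix_hmRelTen, humbertPairAlgInt_hmRelTen_eq, h₀, h₁⟩

/-- **At the `ρ = 3` points of the discriminant-`10` family, `ρ_r(End X_Z) = ℤ[α, β]` is the QCM-order** (`d = 10`).
[cite: Runge1999EndomorphismRingsAbelianSurfaces, §6 Thm. 7 and proof of Cor. 9 (pp. 295–296)] -/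
theorem endRingInt_eq_of_mem_hmRelTen {Z : siegelUpperHalfSpace 2} (h₀ : Z ∈ humbertLocus (fun i ↦ (hmRelTen i : ℂ)))
    (h₁ : Z ∈ humbertLocus (fun i ↦ (hmRelTen' i : ℂ)))
    (h3 : finrank ℤ (neronSeveriGroup (prinPeriod Z : (Fin 2 ⊕ Fin 2 → ℝ) ≃L[ℝ] (Fin 2 → ℂ))) = 3) :
    endRingInt (prinPeriod Z : (Fin 2 ⊕ Fin 2 → ℝ) ≃L[ℝ] (Fin 2 → ℂ)) = (humbertPairOrder hmRelTen hmRelTen').toSubring :=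
  (endRingInt_eq_humbertPairAlgInt_of_endAlgRat_eq
    (endAlgRat_eq_humbertPairAlg_of_finrank_eq_three h₀ h₁ isPrimitiveRel_hmRelTen.2.2 h3)).trans humbertPairAlgInt_hmRelTen_eq

end SaturationHM

/-! ## §4 When every relation of invariant `Δ` is primitive: `H_Δ(𝔥₂) = N_Δ` -/

section AllPrimitive

/-- **`H_Δ(𝔥₂) = N_Δ` whenever no `m ≥ 2` with `m² ∣ Δ` has `Δ/m² ≡ 0, 1 (mod 4)` and `Δ/m² > 0`** — then the strata
`N_{Δ/m²}`, `m ≥ 2`, of `H_Δ(𝔥₂) = ⋃_{m² ∣ Δ} N_{Δ/m²}` (row A4-65 FILE 2) are empty (`N_Δ′ ≠ ∅ ⟺ Δ′ > 0 ∧ Δ′ ≡ 0, 1 (4)`).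
For such `Δ` Runge's / Hashimoto–Murabayashi's and Birkenhake–Wilhelm's Humbert surfaces agree (e.g. `Δ` squarefree,
`Δ = 8, 12`). [cite: HashimotoMurabayashi1995, Def. 3.6] [cite: BirkenhakeWilhelm2003, §1 (∗) (p. 1819) and §4 Prop. 4.7 (p. 1830)] -/
theorem humbertLocusOfInvariant_eq_humbertLocusPrim_of_forall {Δ : ℤ}
    (h : ∀ m : ℤ, 2 ≤ m → m ^ 2 ∣ Δ → ¬ (0 < Δ / m ^ 2 ∧ (Δ / m ^ 2 % 4 = 0 ∨ Δ / m ^ 2 % 4 = 1))) :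
    humbertLocusOfInvariant Δ = humbertLocusPrim Δ := by
  refine Set.Subset.antisymm ?_ (humbertLocusPrim_subset_humbertLocusOfInvariant Δ)
  intro Z hZ
  rw [humbertLocusOfInvariant_eq_iUnion_humbertLocusPrim] at hZ
  obtain ⟨m, ⟨hm, hdvd⟩, hZm⟩ := Set.mem_iUnion₂.1 hZ
  rcases eq_or_lt_of_le (show 1 ≤ m from hm) with rfl | hm2
  · simpa using hZm
  · exact absurd ((humbertLocusPrim_nonempty_iff _).1 ⟨Z, hZm⟩) (h m hm2 hdvd)

/-- `H₁₂(𝔥₂) = N₁₂` (`12/4 = 3 ≢ 0, 1 (mod 4)`). [cite: HashimotoMurabayashi1995, Def. 3.6] -/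
theorem humbertLocusOfInvariant_twelve_eq_humbertLocusPrim : humbertLocusOfInvariant 12 = humbertLocusPrim 12 := by
  refine humbertLocusOfInvariant_eq_humbertLocusPrim_of_forall fun m hm hdvd ↦ ?_
  have hle : m ^ 2 ≤ 12 := Int.le_of_dvd (by norm_num) hdvd
  have hm3 : m ≤ 3 := by nlinarith
  interval_cases m <;> omega

end AllPrimitive

end SiegelModuli

end Literature.AlgebraicGeometry.ModuliOfAbelianVarieties
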